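import Summits.Ventures.CertifiedManyBodySolver.Transport.PauliMarkovFourier
import HarnessLib

/-!
# Ventures/CertifiedManyBodySolver — Transport/TorusBoxFourier.lean

HONEST FRAMING: first certified bounds; not a superconductivity verdict; every number certified or labelled float.

Elementary Fourier analysis on the `d`-torus and box-window combinatorics, for the `ℤ^d` versions of the
cell's Pauli–Markov one-body cuts (LEMMA PM-2D / LEMMA PMP, op-02 `HOME/op/PM-2D.md` §2, §7.4; consumers
`Transport/PauliMarkovMatrixFourier.lean`, `Transport/PauliMarkovMatrix.lean`; the one-direction case is
`Transport/PauliMarkovFourier.lean`):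

* the torus box `(0, 2π]^d ⊂ ℝ^d` (`torusBox`; product of half-open intervals so that each coordinate
  integral is an `intervalIntegral`), Lebesgue measure on it as a product measure, integrability of
  continuous functions on it;
* the characters `χ_m(k) = e^{i k·m} = Π_i e^{i m_i k_i}`, `m ∈ ℤ^d` (`boxChar`), `χ_{m+m'} = χ_m χ_{m'}`,
  `χ_{−m} = conj χ_m`, `|χ_m| = 1`, and ORTHOGONALITY `∫_{(0,2π]^d} χ_m = (2π)^d [m = 0]`
  (`integral_torusBox_boxChar`: Fubini `integral_fintype_prod_eq_prod` + the one-dimensional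
  `integral_cexp_int_mul`);
* the box window `[0, W)^d ⊂ ℤ^d` (`boxSite`, `boxRegion`) and the `d`-DIMENSIONAL FEJÉR PAIR COUNT
  `Σ_{x,y ∈ [0,W)^d} [y − x = m] c = (Π_i (W − |m_i|)) c` (`sum_boxSite_ite_sub_eq`), by distributing the
  product of the coordinate indicators (`Finset.prod_univ_sum`).

Pure real analysis / finite combinatorics; no states, no physical notion, no named fact, no sorry.
-/

noncomputable section

namespace Summit.Ventures.CertifiedManyBodySolver.Transport

open Matrix Finset MeasureTheory
open Literature.Probability.LatticeModels
open Literature.MathematicalPhysics.QuantumLattice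
open scoped ComplexOrder Real

variable {d : ℕ}

/-! ### §1. The torus box `(0, 2π]^d`, characters and orthogonality -/

/-- The fundamental box `(0, 2π]^d ⊂ ℝ^d` of the `d`-torus (half-open in each coordinate, so that each
coordinate integral is an `intervalIntegral` over `0..2π`; it differs from `[0, 2π]^d` by a null set). -/
def torusBox (d : ℕ) : Set (Fin d → ℝ) := Set.univ.pi fun _ => Set.Ioc (0 : ℝ) (2 * π)

/-- The box is measurable. -/
theorem measurableSet_torusBox (d : ℕ) : MeasurableSet (torusBox d) :=
  MeasurableSet.univ_pi fun _ => measurableSet_Ioc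

/-- The half-open box sits inside the compact box `[0, 2π]^d`. -/
theorem torusBox_subset_Icc (d : ℕ) : torusBox d ⊆ Set.univ.pi fun _ : Fin d => Set.Icc (0 : ℝ) (2 * π) :=
  Set.pi_mono fun _ _ => Set.Ioc_subset_Icc_self

/-- Lebesgue measure restricted to the box is the product of the coordinate restrictions. -/
theorem volume_restrict_torusBox (d : ℕ) :
    (volume : Measure (Fin d → ℝ)).restrict (torusBox d) =
      Measure.pi fun _ : Fin d => (volume : Measure ℝ).restrict (Set.Ioc (0 : ℝ) (2 * π)) := by
  rw [volume_pi, torusBox]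
  exact Measure.restrict_pi_pi _ _

/-- A continuous function is integrable on the box. -/
theorem integrableOn_torusBox_of_continuous {E : Type*} [NormedAddCommGroup E] {f : (Fin d → ℝ) → E}
    (hf : Continuous f) : IntegrableOn f (torusBox d) :=
  (hf.continuousOn.integrableOn_compact (isCompact_univ_pi fun _ => isCompact_Icc)).mono_set
    (torusBox_subset_Icc d)

/-- The character `χ_m(k) = e^{i k·m} = Π_i e^{i m_i k_i}` of the frequency `m ∈ ℤ^d`. -/
def boxChar (m : Site d) (k : Fin d → ℝ) : ℂ :=
  ∏ i, Complex.exp (Complex.I * ((m i : ℤ) : ℂ) * ((k i : ℝ) : ℂ))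

/-- `χ_m` is continuous. -/
theorem continuous_boxChar (m : Site d) : Continuous (boxChar m) := by
  unfold boxChar
  exact continuous_finsetProd _ fun i _ => by fun_prop

/-- `χ_{m+m'} = χ_m χ_{m'}`. -/
theorem boxChar_add (m m' : Site d) (k : Fin d → ℝ) : boxChar (m + m') k = boxChar m k * boxChar m' k := by
  simp only [boxChar, Pi.add_apply, Int.cast_add, ← Finset.prod_mul_distrib, ← Complex.exp_add]
  refine Finset.prod_congr rfl fun i _ => ?_
  congr 1
  ring

/-- `χ_0 = 1`. -/
theorem boxChar_zero (k : Fin d → ℝ) : boxChar (0 : Site d) k = 1 := by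
  simp [boxChar]

/-- `χ_{−m} = conj χ_m`. -/
theorem boxChar_neg (m : Site d) (k : Fin d → ℝ) : boxChar (-m) k = star (boxChar m k) := by
  simp only [boxChar, Pi.neg_apply, Int.cast_neg, Complex.star_def, map_prod]
  refine Finset.prod_congr rfl fun i _ => ?_
  rw [← Complex.exp_conj]
  congr 1
  simp only [map_mul, Complex.conj_I, map_intCast, Complex.conj_ofReal]
  ring

/-- `conj(χ_m) χ_{m'} = χ_{m' − m}`. -/
theorem star_boxChar_mul_boxChar (m m' : Site d) (k : Fin d → ℝ) :
    star (boxChar m k) * boxChar m' k = boxChar (m' - m) k := by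
  rw [← boxChar_neg, ← boxChar_add, neg_add_eq_sub]

/-- `χ_a χ_{−r} = χ_{a − r}`. -/
theorem boxChar_sub (a r : Site d) (k : Fin d → ℝ) : boxChar (a - r) k = boxChar (-r) k * boxChar a k := by
  rw [← boxChar_add, neg_add_eq_sub]

/-- `|χ_m(k)| = 1`. -/
theorem norm_boxChar (m : Site d) (k : Fin d → ℝ) : ‖boxChar m k‖ = 1 := by
  rw [boxChar, norm_prod]
  refine Finset.prod_eq_one fun i _ => ?_
  rw [show Complex.I * ((m i : ℤ) : ℂ) * ((k i : ℝ) : ℂ) = (((m i : ℝ) * k i : ℝ) : ℂ) * Complex.I by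
    push_cast; ring, Complex.norm_exp_ofReal_mul_I]

/-- **Orthogonality of characters on the `d`-torus**: `∫_{(0,2π]^d} χ_m(k) dk = (2π)^d [m = 0]`. -/
theorem integral_torusBox_boxChar (m : Site d) :
    ∫ k in torusBox d, boxChar m k = if m = 0 then (2 * (π : ℂ)) ^ d else 0 := by
  rw [volume_restrict_torusBox]
  unfold boxChar
  rw [integral_fintype_prod_eq_prod (𝕜 := ℂ)
    (fun i (y : ℝ) => Complex.exp (Complex.I * ((m i : ℤ) : ℂ) * ((y : ℝ) : ℂ)))]
  have h1 : ∀ i : Fin d,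
      ∫ y in Set.Ioc (0 : ℝ) (2 * π), Complex.exp (Complex.I * ((m i : ℤ) : ℂ) * ((y : ℝ) : ℂ)) =
        if m i = 0 then 2 * (π : ℂ) else 0 := fun i => by
    rw [← intervalIntegral.integral_of_le (by positivity : (0 : ℝ) ≤ 2 * π), integral_cexp_int_mul]
  simp_rw [h1]
  rw [Fintype.prod_ite_zero, Finset.prod_const, Finset.card_univ, Fintype.card_fin]
  by_cases hm : m = 0
  · subst hm
    simp
  · have h : ¬ ∀ i, m i = 0 := fun h => hm (funext h)
    rw [if_neg h, if_neg hm]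

/-! ### §2. Box windows `[0, W)^d` and the `d`-dimensional Fejér pair count -/

/-- The site `(x_1, …, x_d) ∈ ℤ^d` of a window multi-index `x ∈ [0, W)^d`. -/
def boxSite (W : ℕ) (x : Fin d → Fin W) : Site d := fun i => ((x i : ℕ) : ℤ)

/-- Distinct multi-indices give distinct sites. -/
theorem boxSite_injective (W : ℕ) : Function.Injective (boxSite (d := d) W) := by
  intro x y h
  funext i
  have hi := congrFun h i
  simp only [boxSite, Nat.cast_inj] at hi
  exact Fin.ext hi

/-- The window region `[0, W)^d ⊂ ℤ^d`. -/
def boxRegion (W : ℕ) : Finset (Site d) := Finset.univ.image (boxSite (d := d) W)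

/-- Each window site lies in the window region. -/
theorem boxSite_mem (W : ℕ) (x : Fin d → Fin W) : boxSite W x ∈ boxRegion (d := d) W :=
  Finset.mem_image_of_mem _ (Finset.mem_univ x)

/-- One-dimensional pair count, first step (generic coefficients): for `j < W`,
`Σ_{l<W} [l − j = m] c = [0 ≤ j + m < W] c`. -/
theorem sum_range_ite_sub_eq' {β : Type*} [AddCommMonoid β] (W j : ℕ) (m : ℤ) (c : β) :
    ∑ l ∈ Finset.range W, (if ((l : ℤ) - j = m) then c else 0) =
      if (0 ≤ (j : ℤ) + m ∧ (j : ℤ) + m < W) then c else 0 := by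
  by_cases h : 0 ≤ (j : ℤ) + m ∧ (j : ℤ) + m < W
  · rw [if_pos h]
    have hmem : ((j : ℤ) + m).toNat ∈ Finset.range W := by
      rw [Finset.mem_range]; omega
    rw [Finset.sum_eq_single_of_mem _ hmem]
    · rw [if_pos (by omega)]
    · intro l _ hne
      rw [if_neg (by omega)]
  · rw [if_neg h]
    refine Finset.sum_eq_zero fun l hl => ?_
    rw [Finset.mem_range] at hl
    rw [if_neg (by omega)]

/-- One-dimensional pair count, second step (generic coefficients):
`Σ_{j<W} [0 ≤ j + m < W] c = (W − |m|) c`. -/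
theorem sum_range_ite_add_mem_eq' {β : Type*} [NonAssocSemiring β] (W : ℕ) (m : ℤ) (c : β) :
    ∑ j ∈ Finset.range W, (if (0 ≤ (j : ℤ) + m ∧ (j : ℤ) + m < W) then c else 0) =
      ((W - m.natAbs : ℕ) : β) * c := by
  rw [← Finset.sum_filter]
  have hfilter : (Finset.range W).filter (fun j : ℕ => 0 ≤ (j : ℤ) + m ∧ (j : ℤ) + m < W) =
      Finset.Ico ((-m).toNat) (W - m.toNat) := by
    ext j
    simp only [Finset.mem_filter, Finset.mem_range, Finset.mem_Ico]
    omega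
  rw [hfilter, Finset.sum_const, Nat.card_Ico, nsmul_eq_mul]
  congr 2
  omega

/-- **One-dimensional Fejér pair count** over `Fin W`: `Σ_{a,b<W} [b − a = m] c = (W − |m|) c`. -/
theorem sum_fin_fin_ite_sub_eq {β : Type*} [NonAssocSemiring β] (W : ℕ) (m : ℤ) (c : β) :
    ∑ a : Fin W, ∑ b : Fin W, (if ((b : ℕ) : ℤ) - ((a : ℕ) : ℤ) = m then c else 0) =
      ((W - m.natAbs : ℕ) : β) * c := by
  have hinner : ∀ a : ℕ, (∑ b : Fin W, if ((b : ℕ) : ℤ) - (a : ℤ) = m then c else 0) =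
      ∑ l ∈ Finset.range W, if ((l : ℤ) - a = m) then c else 0 :=
    fun a => Fin.sum_univ_eq_sum_range (fun l => if ((l : ℤ) - a = m) then c else 0) W
  rw [Fin.sum_univ_eq_sum_range (fun a => ∑ b : Fin W, if ((b : ℕ) : ℤ) - (a : ℤ) = m then c else 0) W]
  simp_rw [hinner, sum_range_ite_sub_eq']
  exact sum_range_ite_add_mem_eq' W m c

/-- **The `d`-dimensional Fejér pair count**: `Σ_{x,y ∈ [0,W)^d} [y − x = m] c = (Π_i (W − |m_i|)) c`
(the pairs with difference `m` factor over the coordinates). -/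
theorem sum_boxSite_ite_sub_eq {β : Type*} [CommRing β] (W : ℕ) (m : Site d) (c : β) :
    ∑ x : Fin d → Fin W, ∑ y : Fin d → Fin W, (if boxSite W y - boxSite W x = m then c else 0) =
      (∏ i, ((W - (m i).natAbs : ℕ) : β)) * c := by
  classical
  -- the indicator of `y - x = m` is the product of the coordinate indicators
  set φ : Fin d → Fin W → Fin W → β := fun i a b => if ((b : ℕ) : ℤ) - ((a : ℕ) : ℤ) = m i then 1 else 0
    with hφ
  have hind : ∀ x y : Fin d → Fin W, (if boxSite W y - boxSite W x = m then c else 0) =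
      c * ∏ i, φ i (x i) (y i) := by
    intro x y
    rw [hφ, Fintype.prod_boole]
    have : (boxSite W y - boxSite W x = m) ↔ ∀ i, ((y i : ℕ) : ℤ) - ((x i : ℕ) : ℤ) = m i := by
      simp only [funext_iff, Pi.sub_apply, boxSite]
    simp only [this, mul_ite, mul_one, mul_zero]
  simp_rw [hind, ← Finset.mul_sum]
  rw [mul_comm]
  congr 1
  -- `Σ_x Σ_y Π_i φ_i(x_i, y_i) = Π_i Σ_{a,b} φ_i(a, b)` by distributing twice
  have hinner : ∀ x : Fin d → Fin W, ∑ y : Fin d → Fin W, ∏ i, φ i (x i) (y i) =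
      ∏ i, ∑ b : Fin W, φ i (x i) b := by
    intro x
    rw [Finset.prod_univ_sum, Fintype.piFinset_univ]
  have houter : ∑ x : Fin d → Fin W, ∏ i, ∑ b : Fin W, φ i (x i) b = ∏ i, ∑ a : Fin W, ∑ b : Fin W, φ i a b := by
    rw [Finset.prod_univ_sum, Fintype.piFinset_univ]
  simp_rw [hinner]
  rw [houter]
  refine Finset.prod_congr rfl fun i _ => ?_
  rw [hφ]
  simp only
  rw [sum_fin_fin_ite_sub_eq, mul_one]

end Summit.Ventures.CertifiedManyBodySolver.Transport

end
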